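import Summits.SmoothPoincare4.SmoothPoincare4.Theses.EntropyRung
import Literature.Geometry.Riemannian.ShrinkingRoundSphereFour
import Literature.Geometry.Riemannian.RicciFlowMaximal
import Literature.Geometry.Riemannian.CanonicalNeighbourhoods
import Literature.Geometry.Riemannian.PerelmanEntropy
import HarnessLib

/-!
# `SubcylindricalRecognition` — negative knowledge III: the Bamler stub of the picked line is decoupled

Support lemmas for crux `stmt-SmoothPoincare4-10869` (RUNG), picked line `ancient-sphere-rigidity`, reshape r2
(skeleton sha 90cf9aa3e986…), from the standing disprover's work file `Cruxes/SubcylindricalRecognition/Disproof.lean`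
(§8.1), landed so that the lead / planners / triagers can import them.

* `BlowdownConclusion M` — the conclusion of the registered stub `stub_blowdown`, verbatim, as a predicate of `M`
  alone (the blow-up data never occur in it); `StubBlowdown` — the whole stub verbatim; `stubBlowdown_iff`.
* **Decoupling**: `blowdownConclusion_of_sphereDiffeo` — on any `M ≅ S⁴` the conclusion holds OUTRIGHT with the
  round shrinker `S⁴(√6)` of `Literature/Geometry/Riemannian/ShrinkingRoundSphereFour.lean` (`6·g_{S⁴}`, `f ≡ 2`,
  `Ric = ½g`, `R = 2`, `∫e^{-2}dV = 96π²e⁻² > 32π²√π e^{-3/2}`) and the diffeomorphism as the injective immersion;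
  `blowdownConclusion_sphere`, `stubBlowdown_onSphere` (the stub on the standard sphere with all hypotheses idle),
  `spc4_imp_blowdownConclusion` (SPC4 ⇒ the conclusion for every `M ≃ₕ S⁴`). So, like the crux itself
  (`Negative.spc4_imp`), the Bamler stub is SPC4-trivialisable on its only use and carries information exactly on the
  `M` where SPC4 is open: no junk model of its hypotheses on `S⁴` can refute it, and no case split on
  `Nonempty (S⁴ ≃ₘ M)` can prove anything useful.
References: Cao–Hamilton–Ilmanen arXiv:math/0404165 §4 (Θ(S⁴) = 6/e² > Θ(S³×ℝ)); Bamler arXiv:2009.03243 §2.7.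
-/

noncomputable section

set_option linter.dupNamespace false

namespace Summit.SmoothPoincare4.SmoothPoincare4.Theorems.SubcylindricalRecognition.Negative

open scoped Manifold ContDiff Topology ContinuousMap ENNReal NNReal
open MeasureTheory Set Literature.Geometry.Lorentzian Literature.Geometry.Riemannian

/-- The CONCLUSION of the registered stub `stub_blowdown` (Lines/ancient-sphere-rigidity.lean, r2),
verbatim, as a predicate of the closed manifold `M` alone: a complete connected normalised gradient
shrinker `(S, g_S, f_S)` with `R ≢ 0` and `∫ e^{-f_S} dV > 32π²√π e^{-3/2}`, which, if compact,
immerses injectively into `M`. NOTE: the data `(A, g_k, cov_k, x_k, κ, δ', c)` of the stub do not occur. -/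
def BlowdownConclusion (M : Type) [TopologicalSpace M] [ChartedSpace (EuclideanSpace ℝ (Fin 4)) M]
    [IsManifold (𝓡 4) ∞ M] : Prop :=
  ∃ (S : Type) (_ : TopologicalSpace S) (_ : T2Space S) (_ : SecondCountableTopology S)
    (_ : ChartedSpace (EuclideanSpace ℝ (Fin 4)) S) (_ : IsManifold (𝓡 4) ∞ S) (_ : ConnectedSpace S)
    (_ : T3Space S) (_ : MeasurableSpace S) (_ : BorelSpace S)
    (gS : PseudoRiemannianMetric (𝓡 4) ∞ (EuclideanSpace ℝ (Fin 4)) (TangentSpace (𝓡 4) : S → Type _))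
    (_ : gS.HasLeviCivita) (fS : S → ℝ) (hS : gS.IsRiemannian),
    (∀ (x : S) (r : NNReal), IsCompact {y : S | gS.edist hS x y ≤ r}) ∧
    ContMDiff (𝓡 4) 𝓘(ℝ, ℝ) ∞ fS ∧
    (∀ (x : S) (X Y : TangentSpace (𝓡 4) x),
      gS.ricci x X Y + gS.hessian fS x X Y = (1 / 2 : ℝ) * gS.val x X Y) ∧
    (∀ x : S, gS.scalarCurvature x + gS.gradSq fS x = fS x) ∧
    (∃ x : S, gS.scalarCurvature x ≠ 0) ∧
    ENNReal.ofReal (32 * Real.pi ^ 2 * Real.sqrt Real.pi * Real.exp (-(3 : ℝ) / 2)) <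
      ∫⁻ x, ENNReal.ofReal (Real.exp (-fS x))
        ∂(riemannianMeasure (gS.toContMDiffRiemannianMetric hS)) ∧
    (CompactSpace S → ∃ φ : S → M, ContMDiff (𝓡 4) (𝓡 4) ∞ φ ∧ Function.Injective φ ∧
      ∀ x : S, Function.Injective (mfderiv (𝓡 4) (𝓡 4) φ x))

/-- The registered stub `stub_blowdown` (r2) VERBATIM (hypotheses + conclusion), as a `Prop`. -/
def StubBlowdown : Prop :=
    ∀ (M : Type) [TopologicalSpace M] [T2Space M] [SecondCountableTopology M]
      [ChartedSpace (EuclideanSpace ℝ (Fin 4)) M] [IsManifold (𝓡 4) ∞ M] [CompactSpace M]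
      [ConnectedSpace M] [T3Space M] [MeasurableSpace M] [BorelSpace M]
      (A : ℕ → ℝ)
      (gk : ℕ → ℝ → PseudoRiemannianMetric (𝓡 4) ∞ (EuclideanSpace ℝ (Fin 4)) (TangentSpace (𝓡 4) : M → Type _))
      (covk : ℕ → ℝ → CovariantDerivative (𝓡 4) (EuclideanSpace ℝ (Fin 4)) (TangentSpace (𝓡 4) : M → Type _))
      (xk : ℕ → M) (κ δ' c : ℝ), 0 < κ → 0 < δ' → 0 < c →
      (∀ k : ℕ, (k : ℝ) ≤ A k) →
      (∀ k, IsRicciFlow (gk k) (covk k) (Set.Icc (-(A k)) 0)) →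
      (∀ k, ∀ t ∈ Set.Icc (-(A k)) 0, (gk k t).IsRiemannian) →
      (∀ k, ∀ t ∈ Set.Icc (-(A k)) 0, CurvatureBoundedBy (gk k t) (covk k t) 1) →
      (∀ k, ∃ X Y Z W : TangentSpace (𝓡 4) (xk k),
        (gk k 0).val (xk k) X X ≤ 1 ∧ (gk k 0).val (xk k) Y Y ≤ 1 ∧
        (gk k 0).val (xk k) Z Z ≤ 1 ∧ (gk k 0).val (xk k) W W ≤ 1 ∧
        c ≤ |(gk k 0).curvatureForm (covk k 0) (xk k) X Y Z W|) →
      (∀ k, ∀ r₀ : ℝ, 0 < r₀ → r₀ < Real.sqrt (A k) →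
        IsKappaNoncollapsed (gk k) (covk k) (Set.Icc (-(A k)) 0) κ r₀) →
      (∀ k, ∀ t ∈ Set.Icc (-(A k)) 0, ∀ τ : ℝ, 0 < τ →
        ((Real.log 2 + Real.log Real.pi / 2 - 3 / 2 + δ' : ℝ) : EReal) ≤
          (gk k t).muEntropy (covk k t) τ) →
      ∃ (S : Type) (_ : TopologicalSpace S) (_ : T2Space S) (_ : SecondCountableTopology S)
        (_ : ChartedSpace (EuclideanSpace ℝ (Fin 4)) S) (_ : IsManifold (𝓡 4) ∞ S) (_ : ConnectedSpace S)
        (_ : T3Space S) (_ : MeasurableSpace S) (_ : BorelSpace S)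
        (gS : PseudoRiemannianMetric (𝓡 4) ∞ (EuclideanSpace ℝ (Fin 4)) (TangentSpace (𝓡 4) : S → Type _))
        (_ : gS.HasLeviCivita) (fS : S → ℝ) (hS : gS.IsRiemannian),
        (∀ (x : S) (r : NNReal), IsCompact {y : S | gS.edist hS x y ≤ r}) ∧
        ContMDiff (𝓡 4) 𝓘(ℝ, ℝ) ∞ fS ∧
        (∀ (x : S) (X Y : TangentSpace (𝓡 4) x),
          gS.ricci x X Y + gS.hessian fS x X Y = (1 / 2 : ℝ) * gS.val x X Y) ∧
        (∀ x : S, gS.scalarCurvature x + gS.gradSq fS x = fS x) ∧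
        (∃ x : S, gS.scalarCurvature x ≠ 0) ∧
        ENNReal.ofReal (32 * Real.pi ^ 2 * Real.sqrt Real.pi * Real.exp (-(3 : ℝ) / 2)) <
          ∫⁻ x, ENNReal.ofReal (Real.exp (-fS x))
            ∂(riemannianMeasure (gS.toContMDiffRiemannianMetric hS)) ∧
        (CompactSpace S → ∃ φ : S → M, ContMDiff (𝓡 4) (𝓡 4) ∞ φ ∧ Function.Injective φ ∧
          ∀ x : S, Function.Injective (mfderiv (𝓡 4) (𝓡 4) φ x))

/-- The stub is "hypotheses ⇒ `BlowdownConclusion M`" (definitional bookkeeping). [folklore] -/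
theorem stubBlowdown_iff : StubBlowdown ↔
    ∀ (M : Type) [TopologicalSpace M] [T2Space M] [SecondCountableTopology M]
      [ChartedSpace (EuclideanSpace ℝ (Fin 4)) M] [IsManifold (𝓡 4) ∞ M] [CompactSpace M]
      [ConnectedSpace M] [T3Space M] [MeasurableSpace M] [BorelSpace M]
      (A : ℕ → ℝ)
      (gk : ℕ → ℝ → PseudoRiemannianMetric (𝓡 4) ∞ (EuclideanSpace ℝ (Fin 4)) (TangentSpace (𝓡 4) : M → Type _))
      (covk : ℕ → ℝ → CovariantDerivative (𝓡 4) (EuclideanSpace ℝ (Fin 4)) (TangentSpace (𝓡 4) : M → Type _))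
      (xk : ℕ → M) (κ δ' c : ℝ), 0 < κ → 0 < δ' → 0 < c →
      (∀ k : ℕ, (k : ℝ) ≤ A k) →
      (∀ k, IsRicciFlow (gk k) (covk k) (Set.Icc (-(A k)) 0)) →
      (∀ k, ∀ t ∈ Set.Icc (-(A k)) 0, (gk k t).IsRiemannian) →
      (∀ k, ∀ t ∈ Set.Icc (-(A k)) 0, CurvatureBoundedBy (gk k t) (covk k t) 1) →
      (∀ k, ∃ X Y Z W : TangentSpace (𝓡 4) (xk k),
        (gk k 0).val (xk k) X X ≤ 1 ∧ (gk k 0).val (xk k) Y Y ≤ 1 ∧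
        (gk k 0).val (xk k) Z Z ≤ 1 ∧ (gk k 0).val (xk k) W W ≤ 1 ∧
        c ≤ |(gk k 0).curvatureForm (covk k 0) (xk k) X Y Z W|) →
      (∀ k, ∀ r₀ : ℝ, 0 < r₀ → r₀ < Real.sqrt (A k) →
        IsKappaNoncollapsed (gk k) (covk k) (Set.Icc (-(A k)) 0) κ r₀) →
      (∀ k, ∀ t ∈ Set.Icc (-(A k)) 0, ∀ τ : ℝ, 0 < τ →
        ((Real.log 2 + Real.log Real.pi / 2 - 3 / 2 + δ' : ℝ) : EReal) ≤
          (gk k t).muEntropy (covk k t) τ) →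
      BlowdownConclusion M :=
  Iff.rfl

/-- **DECOUPLING (the conclusion of `stub_blowdown` is free on any `M ≅ S⁴`).** Whatever the blow-up
data, if `M` is diffeomorphic to the standard `S⁴` then `BlowdownConclusion M` holds with the ROUND
shrinker `S⁴(√6)` (`6·g_{S⁴}`, `f ≡ 2`, `R = 2`, `∫e^{-2}dV = 96π²e⁻² > 32π²√π e^{-3/2}`; all proved in
`Literature/Geometry/Riemannian/ShrinkingRoundSphereFour.lean`) and the diffeomorphism as the injective
immersion. So the Bamler stub carries information ONLY through manifolds `M` not (known to be)
diffeomorphic to `S⁴` — on its one use in the composition (`M ≃ₕ S⁴`) it is SPC4-trivialisable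
(`spc4_imp_blowdownConclusion`), exactly like the crux (`spc4_imp`). A "proof" of `stub_blowdown` by
case split on `Nonempty (S⁴ ≃ₘ M)` is therefore worthless for the crux; the genuine (Bamler 2020a–c /
BCDMZ) argument is needed precisely for the `M` where SPC4 is open. [folklore] -/
theorem blowdownConclusion_of_sphereDiffeo (M : Type) [TopologicalSpace M]
    [ChartedSpace (EuclideanSpace ℝ (Fin 4)) M] [IsManifold (𝓡 4) ∞ M]
    (e : SphereFour ≃ₘ⟮𝓡 4, 𝓡 4⟯ M) : BlowdownConclusion M := by
  have hpt : SphereFour := ⟨EuclideanSpace.single 0 1, by simp⟩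
  refine ⟨SphereFour, inferInstance, inferInstance, inferInstance, inferInstance, inferInstance,
    inferInstance, inferInstance, inferInstance, inferInstance, shrinkingSphereFourMetric,
    instHasLeviCivitaShrinkingSphereFour, fun _ => 2, isRiemannian_shrinkingSphereFourMetric,
    isCompact_setOf_edist_shrinkingSphereFour_le, contMDiff_const, ?_, ?_, ?_, ?_, ?_⟩
  · intro x X Y
    rw [ricci_shrinkingSphereFourMetric, PseudoRiemannianMetric.hessian_constFun]
    simp
  · intro x
    rw [scalarCurvature_shrinkingSphereFourMetric, PseudoRiemannianMetric.gradSq_const]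
    norm_num
  · exact ⟨hpt, by rw [scalarCurvature_shrinkingSphereFourMetric]; norm_num⟩
  · have h := lintegral_exp_neg_two_shrinkingSphereFour
    simp only [] at h ⊢
    rw [show (fun _ : SphereFour => ENNReal.ofReal (Real.exp (-(2 : ℝ)))) =
        fun _ : SphereFour => ENNReal.ofReal (Real.exp (-2)) from rfl] at h
    rw [h]
    exact (ENNReal.ofReal_lt_ofReal_iff (by positivity)).2 cylinderDensityBound_lt_shrinkingSphereFour
  · intro _
    exact ⟨e, e.contMDiff, e.injective, fun x => (e.mfderivToContinuousLinearEquiv (by simp) x).injective⟩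

/-- The conclusion of `stub_blowdown` holds OUTRIGHT on the standard `S⁴`. [folklore] -/
theorem blowdownConclusion_sphere : BlowdownConclusion SphereFour :=
  blowdownConclusion_of_sphereDiffeo SphereFour (Diffeomorph.refl _ _ _)

/-- **SPC4 ⇒ the conclusion of `stub_blowdown` for every `M ≃ₕ S⁴`, hypotheses unused.** [folklore] -/
theorem spc4_imp_blowdownConclusion (h : _root_.SmoothPoincare4) (M : Type) [TopologicalSpace M]
    [T2Space M] [SecondCountableTopology M] [ChartedSpace (EuclideanSpace ℝ (Fin 4)) M]
    [IsManifold (𝓡 4) ∞ M] (e : M ≃ₕ Metric.sphere (0 : EuclideanSpace ℝ (Fin 5)) 1) : BlowdownConclusion M := by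
  obtain ⟨φ⟩ := h M ‹_› ‹_› e
  exact blowdownConclusion_of_sphereDiffeo M φ.symm

/-- `stub_blowdown` restricted to the standard sphere holds with all eleven hypotheses idle. [folklore] -/
theorem stubBlowdown_onSphere
    (A : ℕ → ℝ)
    (gk : ℕ → ℝ → PseudoRiemannianMetric (𝓡 4) ∞ (EuclideanSpace ℝ (Fin 4))
      (TangentSpace (𝓡 4) : SphereFour → Type _))
    (covk : ℕ → ℝ → CovariantDerivative (𝓡 4) (EuclideanSpace ℝ (Fin 4))
      (TangentSpace (𝓡 4) : SphereFour → Type _))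
    (xk : ℕ → SphereFour) (κ δ' c : ℝ) : 0 < κ → 0 < δ' → 0 < c →
      (∀ k : ℕ, (k : ℝ) ≤ A k) →
      (∀ k, IsRicciFlow (gk k) (covk k) (Set.Icc (-(A k)) 0)) →
      (∀ k, ∀ t ∈ Set.Icc (-(A k)) 0, (gk k t).IsRiemannian) →
      (∀ k, ∀ t ∈ Set.Icc (-(A k)) 0, CurvatureBoundedBy (gk k t) (covk k t) 1) →
      (∀ k, ∃ X Y Z W : TangentSpace (𝓡 4) (xk k),
        (gk k 0).val (xk k) X X ≤ 1 ∧ (gk k 0).val (xk k) Y Y ≤ 1 ∧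
        (gk k 0).val (xk k) Z Z ≤ 1 ∧ (gk k 0).val (xk k) W W ≤ 1 ∧
        c ≤ |(gk k 0).curvatureForm (covk k 0) (xk k) X Y Z W|) →
      (∀ k, ∀ r₀ : ℝ, 0 < r₀ → r₀ < Real.sqrt (A k) →
        IsKappaNoncollapsed (gk k) (covk k) (Set.Icc (-(A k)) 0) κ r₀) →
      (∀ k, ∀ t ∈ Set.Icc (-(A k)) 0, ∀ τ : ℝ, 0 < τ →
        ((Real.log 2 + Real.log Real.pi / 2 - 3 / 2 + δ' : ℝ) : EReal) ≤
          (gk k t).muEntropy (covk k t) τ) →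
      BlowdownConclusion SphereFour :=
  fun _ _ _ _ _ _ _ _ _ _ => blowdownConclusion_sphere

end Summit.SmoothPoincare4.SmoothPoincare4.Theorems.SubcylindricalRecognition.Negative

end
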